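import Summits.BirchSwinnertonDyer.BirchSwinnertonDyer.Theorems.ErratumRoadFiveSigmaLocalGoodFrobenius
import Literature.NumberTheory.EllipticCurves.FrobeniusTateModule
import Literature.NumberTheory.EllipticCurves.TateModuleProjSurjectiveProofs
import Literature.NumberTheory.EllipticCurves.TateModuleFinrankProofs
import HarnessLib

/-!
# Route UniversalToricDescent — Frobenius on `E[p]` at a good place `v ∤ p`, from the Tate module:
# `σ²P − a_v σP + q_v P = 0` and the trace congruence `σ ≡ s on E[p] ⟹ a_v ≡ 2s (mod p)`

Lead prover bsd-wall-utd-p1 g9 (`--supports stmt-BirchSwinnertonDyer-20399`; sequel of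
`UniversalToricDescentGoodLocalTerm`: the inputs that turn its count `#{P ∈ E[p] : σ^{p^R}P = q_v^{p^R}P}`
into Greenberg–Vatsal's `d_v ∈ {0,1,2}` read off `(a_v, q_v) mod p`). For `E = W/K` over a number field,
`p` prime, `v ∤ p` of good reduction, `φ` an arithmetic Frobenius of `K_v` (`IsFrobPow φ 1`) and
`σ = res φ ∈ Γ_K` (an arithmetic Frobenius at `𝔓₀ = adicCompletionPrime K v`,
`SigmaLocal.isArithFrobAt_localMap_of_isFrobPow`), with `a_v = W.frobeniusTraceAt v`, `q_v = #k_v`: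

* `exists_nsmul_eq_of_proj_one_eq_zero` — **`ker(T_p E → E[p]) = p·T_p E`** (shift the compatible
  sequence).
* `smul_smul_sub_smul_add_smul_eq_zero` — **`σ(σP) − a_v·σP + q_v·P = 0` for every `P ∈ E[p]`**:
  Cayley–Hamilton for `ρ_{E,p}(σ)` on `T_p E` (`charpoly = X² − a_v X + q_v` from the tree's PROVED
  trace/determinant of Frobenius, `trace_/det_galoisRepTate_frobenius_of_hasGoodReductionAt_holds`),
  pushed to `E[p]` along the surjection `T_p E → E[p]` (`proj_surjective_of_isAlgClosed_holds`).
* `dvd_frobeniusTraceAt_sub_two_mul` — **if `σ` acts on `E[p]` as an integer scalar `s`, then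
  `p ∣ a_v − 2s`**: `ρ(σ) − s` maps `T_p E` into `p T_p E`, so its trace (in a `ℤ_p`-basis of the free
  rank-`2` module `T_p E`) is divisible by `p`, and `tr(ρ(σ) − s) = a_v − 2s`.

THEOREMS ONLY; no definition, no named fact, no `sorry`. BSD is not advanced by this file.
References: [SilvermanAEC2009] V.2.3.1, VII.4.1, C.21 Remark 21.3; [GreenbergVatsal2000] §2 Prop.
(2.4) (proof, p. 22: "`d_ℓ` is the multiplicity of `ℓ̃⁻¹` as a root of `P̃_ℓ`").
-/

set_option autoImplicit false
-- `…BirchSwinnertonDyer.BirchSwinnertonDyer.Theorems…` is the problem's mandated namespace (D-0017).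
set_option linter.dupNamespace false

noncomputable section

open scoped Classical

namespace Summit.BirchSwinnertonDyer.BirchSwinnertonDyer.Theorems.UniversalToricDescentGoodFrobenius

open Polynomial Function NumberField IsDedekindDomain Field ValuativeRel WeierstrassCurve
open Literature.NumberTheory.EllipticCurves Literature.NumberTheory.GaloisRepresentations
  Literature.NumberTheory.EllipticCurves.BigGaloisRep
  Literature.NumberTheory.GaloisRepresentations.IsNonarchimedeanLocalField
  IsDedekindDomain.HeightOneSpectrum
  Summit.BirchSwinnertonDyer.BirchSwinnertonDyer.Theorems.SigmaLocal

/-! ### §1 `ker(T_p E → E[p]) = p·T_p E` -/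

section Tate

variable {A : Type} [AddCommGroup A] {p : ℕ}

/-- **`ker(proj₁) = p · T_p A`**: a compatible sequence `(x_n)` with `x_1 = 0` is `p · (x_{n+1})_n`.
[cite: SilvermanAEC2009, III.§7 (definition of `T_ℓ`)] -/
theorem exists_nsmul_eq_of_proj_one_eq_zero {x : TateModule A p} (hx : TateModule.proj p 1 x = 0) :
    ∃ y : TateModule A p, x = p • y := by
  have hmem := (mem_tateSubgroup_iff A p).mp x.2
  -- `p^n • x_{n+1} = x_1 = 0`
  have hpow : ∀ n : ℕ, p ^ n • TateModule.proj p (n + 1) x = TateModule.proj p 1 x := by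
    intro n
    induction n with
    | zero => rw [pow_zero, one_smul]
    | succ n ih =>
      rw [pow_succ, mul_smul, ← ih]
      congr 1
      exact hmem.2 (n + 1)
  refine ⟨TateModule.mk (fun n ↦ TateModule.proj p (n + 1) x) (fun n ↦ by rw [hpow n, hx])
    (fun n ↦ hmem.2 (n + 1)), TateModule.ext fun n ↦ ?_⟩
  rw [map_nsmul, TateModule.proj_mk]
  exact (hmem.2 n).symm

end Tate

/-! ### §2 The Frobenius relation on `E[p]` and the trace congruence -/

variable {K : Type} [Field K] [NumberField K] (W : WeierstrassCurve K) [W.IsElliptic] {p : ℕ}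
  [Fact p.Prime] {v : HeightOneSpectrum (𝓞 K)}

/-- **Cayley–Hamilton for Frobenius on `T_p E` at a good `v ∤ p`**: `ρ(σ)(ρ(σ) x) − a_v ρ(σ) x + q_v x = 0`
for `σ = res φ`, `φ` an arithmetic Frobenius of `K_v`. [cite: SilvermanAEC2009, C.21 Remark 21.3] -/
theorem galoisRepTate_relation (hpv : (p : 𝓞 K) ∉ v.asIdeal) (hv : W.HasGoodReductionAt v)
    {φ : absoluteGaloisGroup (v.adicCompletion K)} (hφ : IsFrobPow φ 1) (x : W.tateModule p) :
    absGaloisRestrict K (v.adicCompletion K) φ • (absGaloisRestrict K (v.adicCompletion K) φ • x) -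
        (W.frobeniusTraceAt v) • (absGaloisRestrict K (v.adicCompletion K) φ • x) +
      (Nat.card (IsLocalRing.ResidueField (v.adicCompletionIntegers K))) • x = 0 := by
  haveI := module_free_tateModule_holds W p
  haveI := module_finite_tateModule_holds W p
  have hp : (p : ℕ).Prime := Fact.out
  have hpK : (p : K) ≠ 0 := by exact_mod_cast hp.ne_zero
  set σ : absoluteGaloisGroup K := absGaloisRestrict K (v.adicCompletion K) φ with hσdef
  have hσ : IsArithFrobAt (𝓞 K) σ (adicCompletionPrime K v) := isArithFrobAt_localMap_of_isFrobPow hφ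
  set f : W.tateModule p →ₗ[ℤ_[p]] W.tateModule p := W.galoisRepTate p σ with hfdef
  have htr := W.trace_galoisRepTate_frobenius_of_hasGoodReductionAt_holds p v hpv hv
    (adicCompletionPrime_mem_primesAbove K v) hσ
  have hdet := W.det_galoisRepTate_frobenius_of_hasGoodReductionAt_holds p v hpv hv
    (adicCompletionPrime_mem_primesAbove K v) hσ
  have hCH := LinearMap.aeval_self_charpoly f
  rw [charpoly_tateModule_eq hpK f, htr, hdet] at hCH
  have happ := congrArg (fun g : W.tateModule p →ₗ[ℤ_[p]] W.tateModule p ↦ g x) hCH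
  simp only [map_add, map_sub, map_mul, aeval_X, aeval_C, LinearMap.add_apply,
    LinearMap.sub_apply, LinearMap.zero_apply, Module.End.mul_apply, pow_two,
    Module.algebraMap_end_apply] at happ
  rw [Int.cast_smul_eq_zsmul, Nat.cast_smul_eq_nsmul] at happ
  simpa only [hfdef, galoisRepTate_apply_apply] using happ

/-- **`σ(σP) − a_v·σP + q_v·P = 0` on `E[p]`** at a good place `v ∤ p`, for `σ = res φ` with `φ` an
arithmetic Frobenius of `K_v` (`a_v = W.frobeniusTraceAt v`, `q_v = #k_v`): Cayley–Hamilton on `T_p E`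
pushed along the surjection `T_p E → E[p]`. [cite: SilvermanAEC2009, V.2.3.1 and C.21 Remark 21.3]
[cite: GreenbergVatsal2000, §2 Prop. (2.4) (proof, p. 22)] -/
theorem smul_smul_sub_smul_add_smul_eq_zero (hpv : (p : 𝓞 K) ∉ v.asIdeal) (hv : W.HasGoodReductionAt v)
    {φ : absoluteGaloisGroup (v.adicCompletion K)} (hφ : IsFrobPow φ 1) (P : W.geomTorsion (p : ℤ)) :
    absGaloisRestrict K (v.adicCompletion K) φ • (absGaloisRestrict K (v.adicCompletion K) φ • P) -
        (W.frobeniusTraceAt v) • (absGaloisRestrict K (v.adicCompletion K) φ • P) +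
      (Nat.card (IsLocalRing.ResidueField (v.adicCompletionIntegers K))) • P = 0 := by
  set σ : absoluteGaloisGroup K := absGaloisRestrict K (v.adicCompletion K) φ with hσdef
  -- lift `P` to the Tate module
  have hP : (P : W.geomPoints) ∈ W.geomTorsion ((p ^ 1 : ℕ) : ℤ) := by
    rw [pow_one]; exact P.2
  obtain ⟨x, hx⟩ := proj_surjective_of_isAlgClosed_holds W p 1 hP
  have hrel := congrArg (TateModule.proj p 1) (galoisRepTate_relation W hpv hv hφ x)
  rw [map_add, map_sub, map_nsmul, map_zsmul, TateModule.proj_smul_of_distribMulAction,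
    TateModule.proj_smul_of_distribMulAction, hx, map_zero] at hrel
  apply Subtype.ext
  simpa only [AddSubgroupClass.coe_sub, AddMemClass.coe_add, AddSubgroup.torsionBy.coe_smul,
    AddSubgroupClass.coe_zsmul, AddSubmonoidClass.coe_nsmul, ZeroMemClass.coe_zero] using hrel

/-- **Trace congruence: if Frobenius acts on `E[p]` as an integer scalar `s` then `p ∣ a_v − 2s`.**
(`ρ(σ) − s` maps `T_p E` into `ker(T_p E → E[p]) = p T_p E`, so in a `ℤ_p`-basis of the free rank-`2`
module `T_p E` its matrix is divisible by `p`, hence so is its trace `a_v − 2s`.)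
[cite: SilvermanAEC2009, III.§7, V.2.3.1] -/
theorem dvd_frobeniusTraceAt_sub_two_mul (hpv : (p : 𝓞 K) ∉ v.asIdeal) (hv : W.HasGoodReductionAt v)
    {φ : absoluteGaloisGroup (v.adicCompletion K)} (hφ : IsFrobPow φ 1) {s : ℤ}
    (hs : ∀ P : W.geomTorsion (p : ℤ), absGaloisRestrict K (v.adicCompletion K) φ • P = s • P) :
    (p : ℤ) ∣ W.frobeniusTraceAt v - 2 * s := by
  haveI := module_free_tateModule_holds W p
  haveI := module_finite_tateModule_holds W p
  have hp : (p : ℕ).Prime := Fact.out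
  have hpK : (p : K) ≠ 0 := by exact_mod_cast hp.ne_zero
  set σ : absoluteGaloisGroup K := absGaloisRestrict K (v.adicCompletion K) φ with hσdef
  have hσ : IsArithFrobAt (𝓞 K) σ (adicCompletionPrime K v) := isArithFrobAt_localMap_of_isFrobPow hφ
  set f : W.tateModule p →ₗ[ℤ_[p]] W.tateModule p := W.galoisRepTate p σ with hfdef
  have htr := W.trace_galoisRepTate_frobenius_of_hasGoodReductionAt_holds p v hpv hv
    (adicCompletionPrime_mem_primesAbove K v) hσ
  -- `g = f - s` has image in `p T`
  set g : W.tateModule p →ₗ[ℤ_[p]] W.tateModule p := f - algebraMap ℤ_[p] _ (s : ℤ_[p]) with hgdef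
  have hg : ∀ x : W.tateModule p, ∃ y : W.tateModule p, g x = (p : ℤ_[p]) • y := by
    intro x
    have hx1 : TateModule.proj p 1 (g x) = 0 := by
      have hmem : TateModule.proj p 1 x ∈ W.geomTorsion (p : ℤ) := by
        have h := W.proj_tateModule_mem_geomTorsion p 1 x
        rwa [pow_one] at h
      have hsx := congrArg Subtype.val (hs ⟨TateModule.proj p 1 x, hmem⟩)
      rw [AddSubgroup.torsionBy.coe_smul, AddSubgroupClass.coe_zsmul] at hsx
      rw [hgdef, LinearMap.sub_apply, Module.algebraMap_end_apply, map_sub, hfdef,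
        galoisRepTate_apply_apply, TateModule.proj_smul_of_distribMulAction, Int.cast_smul_eq_zsmul,
        map_zsmul, sub_eq_zero]
      exact hsx
    obtain ⟨y, hy⟩ := exists_nsmul_eq_of_proj_one_eq_zero hx1
    exact ⟨y, by rw [hy, Nat.cast_smul_eq_nsmul]⟩
  choose y hy using hg
  -- trace in a basis
  let b := Module.finBasisOfFinrankEq ℤ_[p] (W.tateModule p) (finrank_tateModule_eq_two_holds W p hpK)
  have htrace : LinearMap.trace ℤ_[p] _ g = (p : ℤ_[p]) * ∑ i, b.repr (y (b i)) i := by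
    rw [LinearMap.trace_eq_matrix_trace ℤ_[p] b g, Matrix.trace, Finset.mul_sum]
    refine Finset.sum_congr rfl fun i _ ↦ ?_
    rw [Matrix.diag_apply, LinearMap.toMatrix_apply, hy, map_smul, Finsupp.smul_apply, smul_eq_mul]
  have htrace' : LinearMap.trace ℤ_[p] _ g = (W.frobeniusTraceAt v : ℤ_[p]) - 2 * (s : ℤ_[p]) := by
    rw [hgdef, map_sub, htr, Algebra.algebraMap_eq_smul_one, map_smul, LinearMap.trace_one,
      finrank_tateModule_eq_two_holds W p hpK, smul_eq_mul]
    push_cast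
    ring
  -- read the congruence in `ℤ`
  have hdvd : (p : ℤ_[p]) ∣ ((W.frobeniusTraceAt v - 2 * s : ℤ) : ℤ_[p]) := by
    push_cast
    rw [← htrace', htrace]
    exact dvd_mul_right _ _
  have hnorm : ‖((W.frobeniusTraceAt v - 2 * s : ℤ) : ℤ_[p])‖ < 1 := by
    obtain ⟨c, hc⟩ := hdvd
    rw [hc, norm_mul, PadicInt.norm_p]
    have h1 : ‖c‖ ≤ 1 := PadicInt.norm_le_one c
    have hp1 : (1 : ℝ) < p := by exact_mod_cast hp.one_lt
    calc (p : ℝ)⁻¹ * ‖c‖ ≤ (p : ℝ)⁻¹ * 1 := by gcongr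
      _ < 1 := by rw [mul_one]; exact inv_lt_one_of_one_lt₀ hp1
  exact (PadicInt.norm_int_lt_one_iff_dvd _).mp hnorm

end Summit.BirchSwinnertonDyer.BirchSwinnertonDyer.Theorems.UniversalToricDescentGoodFrobenius

end
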